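import Mathlib
import Summits.KontsevichZagierPeriods.KontsevichZagierPeriods.Theorems.SoloInformedInversionWTwelve
import Literature.NumberTheory.Transcendental.KZBetaChains
import Literature.NumberTheory.Transcendental.KZLogCalculusProofs
import Literature.NumberTheory.Transcendental.KZSemialgebraicComplex
import HarnessLib
import HarnessLib.Audit

/-!
# The inversion move on Beta periods of the SECOND kind (solo-informed, s23) — THEOREM XIII

The second-kind companion of the inversion move of Theorem XI (`SoloInformedInversionChain`):
for every rational `p` with `½ < p < 3/2`, putting `q = 3/2 − p`, `b = 2p − 1`, `c = p − ½`, the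
SAME algebraic change of variables `u = ((1 − t)/(1 + t))²` on `(0,1)` carries the Beta form
`u^{p−1}(1−u)^{q−1} du` to

  `4^q · t^{q−1} (1−t)^{b} (1+t)^{−2} dt`                     (`soloInformed_inversion₂_integrand_identity`)

— NOT a Beta form: a form of the rank-one local system of `β(q, b)` with an extra DOUBLE POLE at
the new fibre point `t = −1` (the point over `u = ∞`; pulled-back local exponent `2(1−p−q) = −1`).
Since the twisted cohomology `H¹(ℙ¹ ∖ {0,1,∞}; L_{q,b})` is one-dimensional, this form is a
multiple of the Beta form PLUS AN EXACT FORM, with an explicit algebraic primitive: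

  `t^{q−1}(1−t)^{b}/(1+t)² = c · t^{q−1}(1−t)^{b−1} + d/dt [ t^{q}(1−t)^{b}/(1+t) ]`,

`G(t) = t^q (1−t)^b/(1+t)` vanishing at BOTH ends of `[0,1]`.  Hence, inside the
Kontsevich–Zagier calculus — ONE change of variables (rule 2), ONE additivity of integrands
(rule 1b), ONE Newton–Leibniz move over the point (rule 3: `[[0,1], G′] ∼ [pt, G(1) − G(0)] = [pt,0]`)
and the null boundary —

  `⟦[pt, 4^q]⟧ · ⟦[pt, c]⟧ · ⟦β(q, b)⟧ = ⟦β(p, q)⟧`           (`soloInformed_secondKind_inversion_chain`),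

i.e. `B(p, 3/2 − p) = 4^{3/2−p} (p − ½) B(3/2 − p, 2p − 1)`: a one-parameter family of relations
among Beta periods of the second kind at every level, realised WITHOUT cancellation and without
`π`.  The level-6 cycle relations W45, W25 of `y² = x³ + 1` are its instances `p = ⅚, ⅔`
(file `SoloInformedSecondKindCycles`).

References: M. Kontsevich, D. Zagier, *Periods* (2001), §1.2; G. Andrews, R. Askey, R. Roy,
*Special Functions* (1999), §1.1; P. Deligne, G. Mostow, *Monodromy of hypergeometric functions and
non-lattice integral monodromy*, Publ. IHÉS 63 (1986), §2; this work (solo-informed s23).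
-/

noncomputable section

open MeasureTheory Set Filter
open scoped Classical

open Literature.NumberTheory.Transcendental Literature.NumberTheory.Transcendental.KZ
open Literature.ModelTheory.ExponentialFields

namespace Summit.KontsevichZagierPeriods.KontsevichZagierPeriods.Theorems

/-! ### The integrand identity of the inversion move on second-kind forms -/

/-- **Integrand identity** (second kind): for `t ∈ (0,1)`, rational `p` and `q = 3/2 − p`,
`b = 2p − 1`:  `4^q · t^{q−1}(1−t)^{b}/(1+t)² = φ(t)^{p−1} (1 − φ(t))^{q−1} |φ′(t)|`,
`φ(t) = ((1−t)/(1+t))²`. [this work] -/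
theorem soloInformed_inversion₂_integrand_identity (p q b : ℚ) (hq : q = 3 / 2 - p)
    (hb : b = 2 * p - 1) {t : ℝ} (h0 : 0 < t) (h1 : t < 1) :
    (4:ℝ) ^ (q : ℝ) * ((t ^ ((q : ℝ) - 1) * (1 - t) ^ (b : ℝ)) / (1 + t) ^ 2) =
      soloInformedQuotFun t ^ ((p : ℝ) - 1) *
        (1 - soloInformedQuotFun t) ^ ((q : ℝ) - 1) * |soloInformedQuotDeriv t| := by
  subst hq hb
  have hP : 0 < 1 - t := by linarith
  have hS : 0 < 1 + t := by linarith
  have hr : 0 < (1 - t) / (1 + t) := div_pos hP hS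
  have e0 : (1 - t) ^ (((2 * p - 1 : ℚ)) : ℝ) = (1 - t) ^ (2 * (p : ℝ)) / (1 - t) := by
    rw [show (((2 * p - 1 : ℚ)) : ℝ) = 2 * (p : ℝ) - 1 by push_cast; ring, Real.rpow_sub_one hP.ne']
  have eT : t ^ ((((3 / 2 - p : ℚ)) : ℝ) - 1) = t ^ (((3 / 2 - p : ℚ)) : ℝ) / t :=
    Real.rpow_sub_one h0.ne' _
  have e1 : soloInformedQuotFun t ^ ((p : ℝ) - 1) =
      (1 - t) ^ (2 * (p : ℝ)) / (1 + t) ^ (2 * (p : ℝ)) * ((1 + t) * (1 + t)) /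
        ((1 - t) * (1 - t)) := by
    unfold soloInformedQuotFun
    rw [← Real.rpow_natCast _ 2, ← Real.rpow_mul hr.le,
      show ((2 : ℕ) : ℝ) * ((p : ℝ) - 1) = 2 * (p : ℝ) - ((2 : ℕ) : ℝ) by push_cast; ring,
      Real.rpow_sub hr, Real.rpow_natCast, Real.div_rpow hP.le hS.le]
    have hP' : 1 - t ≠ 0 := hP.ne'
    have hS' : 1 + t ≠ 0 := hS.ne'
    rw [div_pow]
    field_simp
  have e2 : (1 - soloInformedQuotFun t) ^ ((((3 / 2 - p : ℚ)) : ℝ) - 1) =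
      (4:ℝ) ^ (((3 / 2 - p : ℚ)) : ℝ) / 4 * (t ^ (((3 / 2 - p : ℚ)) : ℝ) / t) /
        ((1 + t) / (1 + t) ^ (2 * (p : ℝ))) := by
    rw [soloInformed_one_sub_quotFun hS.ne', Real.div_rpow (by positivity) (by positivity),
      Real.mul_rpow (by norm_num) h0.le, Real.rpow_sub_one (by norm_num) ((((3 / 2 - p : ℚ)) : ℝ)),
      Real.rpow_sub_one h0.ne', ← Real.rpow_natCast (1 + t) 2, ← Real.rpow_mul hS.le,
      show ((2 : ℕ) : ℝ) * ((((3 / 2 - p : ℚ)) : ℝ) - 1) = 1 - 2 * (p : ℝ) by push_cast; ring,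
      Real.rpow_sub hS, Real.rpow_one]
  have e3 : |soloInformedQuotDeriv t| = 4 * (1 - t) / (1 + t) ^ 3 := by
    unfold soloInformedQuotDeriv
    rw [abs_neg, abs_of_pos (by positivity)]
  rw [e0, eT, e1, e2, e3]
  have h4 : (4:ℝ) ^ (((3 / 2 - p : ℚ)) : ℝ) ≠ 0 := (Real.rpow_pos_of_pos (by norm_num) _).ne'
  have hta : t ^ (((3 / 2 - p : ℚ)) : ℝ) ≠ 0 := (Real.rpow_pos_of_pos h0 _).ne'
  have hPa : (1 - t) ^ (2 * (p : ℝ)) ≠ 0 := (Real.rpow_pos_of_pos hP _).ne'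
  have hSa : (1 + t) ^ (2 * (p : ℝ)) ≠ 0 := (Real.rpow_pos_of_pos hS _).ne'
  have hP' : 1 - t ≠ 0 := hP.ne'
  have hS' : 1 + t ≠ 0 := hS.ne'
  have ht' : t ≠ 0 := h0.ne'
  field_simp

/-! ### The pulled-back representation `[(0,1), t^{q−1}(1−t)^{b}/(1+t)²]` -/

/-- The representation `S_{q,b} = [(0,1), t^{q−1}(1−t)^{b}/(1+t)²]` exists for rational `q, b > 0`
(semialgebraic integrand; integrable: a Beta integrand times a bounded continuous factor).
[this work] -/
theorem soloInformed_exists_secondKindRep (q b : ℚ) (hq : 0 < q) (hb : 0 < b) :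
    ∃ S : IntegralRep 1, S.domain = {t | t 0 ∈ Ioo (0:ℝ) 1} ∧
      S.integrand = fun t => (t 0) ^ ((q : ℝ) - 1) * (1 - t 0) ^ (b : ℝ) / (1 + t 0) ^ 2 := by
  have hqR : (0:ℝ) < q := by exact_mod_cast hq
  have hbR : (0:ℝ) < b := by exact_mod_cast hb
  have hsa : IsSemialgebraicFunOn ℚ {t : Fin 1 → ℝ | t 0 ∈ Ioo (0:ℝ) 1}
      (fun t => (t 0) ^ ((q : ℝ) - 1) * (1 - t 0) ^ (b : ℝ) / (1 + t 0) ^ 2) := by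
    have hf := isSemialgebraicFunOn_const_mul_rpow_mul_rpow 1 (q - 1) b
    have hg := isSemialgebraicFunOn_aeval BallPeeling.isSemialgebraic_posIoo
      ((1 + MvPolynomial.X 0) ^ 2 : MvPolynomial (Fin 1) ℚ)
    refine (IsSemialgebraicFunOn.div hf hg fun x hx => ?_).congr fun x _ => ?_
    · have hx' : 0 < x 0 ∧ x 0 < 1 := hx
      have : (1 + x 0) ≠ 0 := by linarith [hx'.1]
      simpa using pow_ne_zero 2 this
    · simp only [Rat.cast_one, one_mul, Rat.cast_sub, map_pow, map_add, map_one,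
        MvPolynomial.aeval_X]
  have hI : IntegrableOn (fun t : ℝ => t ^ ((q : ℝ) - 1) * (1 - t) ^ (b : ℝ) / (1 + t) ^ 2)
      (Ioo (0:ℝ) 1) := by
    have h1 : IntegrableOn (fun t : ℝ => t ^ ((q : ℝ) - 1) * (1 - t) ^ (b : ℝ)) (Ioo (0:ℝ) 1) := by
      have h := (Literature.Analysis.SpecialFunctions.Selberg.integrableOn_Ioo_rpow_mul_one_sub_rpow_and_integral_eq
        hqR (by linarith : (0:ℝ) < b + 1)).1
      simpa only [add_sub_cancel_right] using h
    have h2 : ContinuousOn (fun t : ℝ => ((1 + t) ^ 2)⁻¹) (Icc (0:ℝ) 1) :=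
      ((continuousOn_const.add continuousOn_id).pow 2).inv₀ fun t ht => by
        show ((1:ℝ) + t) ^ 2 ≠ 0
        exact pow_ne_zero 2 (add_pos_of_pos_of_nonneg one_pos ht.1).ne'
    refine (h1.mul_continuousOn_of_subset h2 measurableSet_Ioo isCompact_Icc
      Ioo_subset_Icc_self).congr_fun (fun t _ => ?_) measurableSet_Ioo
    simp only [div_eq_mul_inv]
  exact ⟨⟨_, _, BallPeeling.isSemialgebraic_posIoo, hsa, integrableOn_setOf_apply_mem_iff.2 hI⟩,
    rfl, rfl⟩

/-! ### The cohomological reduction: `[S_{q,b}] ∼ [(0,1), c · t^{q−1}(1−t)^{b−1}]` -/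

/-- **Pointwise identity behind the reduction**: for `t ∈ (0,1)`, `q = 3/2 − p`, `b = 2p − 1`,
`c = p − ½`, the derivative of `G(t) = t^q (1−t)^b (1+t)^{−1}` (in the shape produced by the
product rule) equals `t^{q−1}(1−t)^b/(1+t)² − c · t^{q−1}(1−t)^{b−1}`. [this work] -/
theorem soloInformed_secondKind_pointwise (p q b c : ℚ) (hq : q = 3 / 2 - p) (hb : b = 2 * p - 1)
    (hc : c = p - 1 / 2) {t : ℝ} (ht : t ∈ Ioo (0:ℝ) 1) :
    ((q : ℝ) * t ^ ((q : ℝ) - 1) * (1 - t) ^ (b : ℝ) +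
        t ^ (q : ℝ) * (-1 * (b : ℝ) * (1 - t) ^ ((b : ℝ) - 1))) * (1 + t)⁻¹ +
      t ^ (q : ℝ) * (1 - t) ^ (b : ℝ) * (-1 / (1 + t) ^ 2) =
    t ^ ((q : ℝ) - 1) * (1 - t) ^ (b : ℝ) / (1 + t) ^ 2 -
      (c : ℝ) * (t ^ ((q : ℝ) - 1) * (1 - t) ^ ((b : ℝ) - 1)) := by
  subst hq hb hc
  have ht0 : t ≠ 0 := ht.1.ne'
  have h1t : 1 - t ≠ 0 := (sub_pos.2 ht.2).ne'
  have hS : 1 + t ≠ 0 := by linarith [ht.1]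
  have e1 : t ^ ((((3 / 2 - p : ℚ)) : ℝ)) = t ^ ((((3 / 2 - p : ℚ)) : ℝ) - 1) * t := by
    rw [Real.rpow_sub_one ht0, div_mul_cancel₀ _ ht0]
  have e2 : (1 - t) ^ ((((2 * p - 1 : ℚ)) : ℝ)) = (1 - t) ^ ((((2 * p - 1 : ℚ)) : ℝ) - 1) * (1 - t) := by
    rw [Real.rpow_sub_one h1t, div_mul_cancel₀ _ h1t]
  rw [e1, e2]
  push_cast
  field_simp
  ring

/-- **The reduction (rules 1b, 3 and the null boundary).** For `½ < p < 3/2`, `q = 3/2 − p`,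
`b = 2p − 1`, `c = p − ½`, a representation `S` pinned as `[(0,1), t^{q−1}(1−t)^b/(1+t)²]` is
KZ-equivalent to any `ρ'` pinned as `[(0,1), c · t^{q−1}(1−t)^{b−1}]`: ONE Newton–Leibniz move
over the point with the primitive `G(t) = t^q(1−t)^b/(1+t)` on `[0,1]` (`G(0) = G(1) = 0`, so
`[[0,1], G′] ∼ [pt, 0] ∼ 0`), the null boundary `{0,1}`, and ONE additivity of integrands.
[Kontsevich–Zagier 2001, §1.2 rules (1),(3); this work] -/
theorem soloInformed_secondKind_reduction (p q b c : ℚ) (hq : q = 3 / 2 - p) (hb : b = 2 * p - 1)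
    (hc : c = p - 1 / 2) (hp : 1 / 2 < p) (hp' : p < 3 / 2) (S ρ' : IntegralRep 1)
    (hSd : S.domain = {t | t 0 ∈ Ioo (0:ℝ) 1})
    (hSi : EqOn S.integrand
      (fun t => (t 0) ^ ((q : ℝ) - 1) * (1 - t 0) ^ (b : ℝ) / (1 + t 0) ^ 2) S.domain)
    (hρ'd : ρ'.domain = {t | t 0 ∈ Ioo (0:ℝ) 1})
    (hρ'i : EqOn ρ'.integrand
      (fun t => (c : ℝ) * ((t 0) ^ ((q : ℝ) - 1) * (1 - t 0) ^ ((b : ℝ) - 1))) ρ'.domain) :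
    Equivalent S ρ' := by
  have hq0 : 0 < q := by rw [hq]; linarith
  have hb0 : 0 < b := by rw [hb]; linarith
  have hqR : (0:ℝ) < q := by exact_mod_cast hq0
  have hbR : (0:ℝ) < b := by exact_mod_cast hb0
  have hq' : (q:ℝ) ≠ 0 := hqR.ne'
  have hb' : (b:ℝ) ≠ 0 := hbR.ne'
  -- the derivative of the primitive, extended by `0` to the closed interval
  set g : ℝ → ℝ := fun t => if t ∈ Ioo (0:ℝ) 1 then
      ((q : ℝ) * t ^ ((q : ℝ) - 1) * (1 - t) ^ (b : ℝ) +
          t ^ (q : ℝ) * (-1 * (b : ℝ) * (1 - t) ^ ((b : ℝ) - 1))) * (1 + t)⁻¹ +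
        t ^ (q : ℝ) * (1 - t) ^ (b : ℝ) * (-1 / (1 + t) ^ 2)
    else 0 with hgdef
  have hgt : ∀ t ∈ Ioo (0:ℝ) 1, g t =
      t ^ ((q : ℝ) - 1) * (1 - t) ^ (b : ℝ) / (1 + t) ^ 2 -
        (c : ℝ) * (t ^ ((q : ℝ) - 1) * (1 - t) ^ ((b : ℝ) - 1)) := fun t ht => by
    simp only [hgdef, if_pos ht]
    exact soloInformed_secondKind_pointwise p q b c hq hb hc ht
  -- integrability of `g`
  obtain ⟨S₀, hS₀d, hS₀i⟩ := soloInformed_exists_secondKindRep q b hq0 hb0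
  have hIS : IntegrableOn (fun t : ℝ => t ^ ((q : ℝ) - 1) * (1 - t) ^ (b : ℝ) / (1 + t) ^ 2)
      (Ioo (0:ℝ) 1) := by
    have h := S₀.integrableOn
    rw [hS₀d, hS₀i] at h
    exact integrableOn_setOf_apply_mem_iff.1 h
  have hIA : IntegrableOn (fun t : ℝ => t ^ ((q : ℝ) - 1) * (1 - t) ^ ((b : ℝ) - 1)) (Ioo (0:ℝ) 1) :=
    (Literature.Analysis.SpecialFunctions.Selberg.integrableOn_Ioo_rpow_mul_one_sub_rpow_and_integral_eq
      hqR hbR).1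
  have hgi : IntegrableOn g (Icc (0:ℝ) 1) := by
    rw [integrableOn_Icc_iff_integrableOn_Ioo]
    exact (hIS.sub (hIA.const_mul (c : ℝ))).congr_fun (fun t ht => (hgt t ht).symm)
      measurableSet_Ioo
  -- semialgebraicity of `g` on `[0,1]`
  have hg_sa : IsSemialgebraicFunOn ℚ {x : Fin 1 → ℝ | x 0 ∈ Icc (0:ℝ) 1}
      (fun x : Fin 1 → ℝ => g (x 0)) := by
    refine isSemialgebraicFunOn_Icc_of_Ioo ?_ 0 0 (fun x hx => ?_) (fun x hx => ?_)
    · have hpos : ∀ x ∈ {x : Fin 1 → ℝ | x 0 ∈ Ioo (0:ℝ) 1}, (1 + x 0) ≠ 0 := fun x hx => by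
        have hx' : 0 < x 0 ∧ x 0 < 1 := hx
        linarith [hx'.1]
      have h1 := isSemialgebraicFunOn_aeval BallPeeling.isSemialgebraic_posIoo
        ((1 + MvPolynomial.X 0) : MvPolynomial (Fin 1) ℚ)
      have h2 := isSemialgebraicFunOn_aeval BallPeeling.isSemialgebraic_posIoo
        ((1 + MvPolynomial.X 0) ^ 2 : MvPolynomial (Fin 1) ℚ)
      have hA := IsSemialgebraicFunOn.div
        (IsSemialgebraicFunOn.add_holds (isSemialgebraicFunOn_const_mul_rpow_mul_rpow q (q - 1) b)
          (isSemialgebraicFunOn_const_mul_rpow_mul_rpow (-b) q (b - 1))) h1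
        fun x hx => by simpa using hpos x hx
      have hB := IsSemialgebraicFunOn.div (isSemialgebraicFunOn_const_mul_rpow_mul_rpow (-1) q b) h2
        fun x hx => by simpa using pow_ne_zero 2 (hpos x hx)
      refine (IsSemialgebraicFunOn.add_holds hA hB).congr fun x hx => ?_
      have hx' : x 0 ∈ Ioo (0:ℝ) 1 := hx
      have hS : (1 + x 0) ≠ 0 := hpos x hx
      simp only [hgdef, if_pos hx', Pi.add_apply, Rat.cast_sub, Rat.cast_one, Rat.cast_neg, map_pow,
        map_add, map_one, MvPolynomial.aeval_X]
      field_simp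
    · have : x 0 ∉ Ioo (0:ℝ) 1 := fun h => by rw [hx] at h; exact lt_irrefl _ h.1
      simp only [hgdef, if_neg this, Rat.cast_zero]
    · have : x 0 ∉ Ioo (0:ℝ) 1 := fun h => by rw [hx] at h; exact lt_irrefl _ h.2
      simp only [hgdef, if_neg this, Rat.cast_zero]
  -- the band representation `D = [[0,1], g]` and the base `Z = [pt, 0]`
  obtain ⟨D, hDd, hDi⟩ : ∃ D : IntegralRep 1, D.domain = {x : Fin 1 → ℝ | x 0 ∈ Icc (0:ℝ) 1} ∧
      D.integrand = fun x => g (x 0) :=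
    ⟨⟨_, _, isSemialgebraic_setOf_apply_mem_Icc, hg_sa, integrableOn_setOf_apply_mem_iff.2 hgi⟩,
      rfl, rfl⟩
  obtain ⟨Z, hZd, hZi⟩ : ∃ Z : IntegralRep 0, Z.domain = univ ∧ Z.integrand = 0 :=
    exists_zeroRep isSemialgebraic_univ
  -- the primitive `G(t) = t^q (1-t)^b (1+t)⁻¹`
  have hF_sa : IsSemialgebraicFunOn ℚ {x : Fin 1 → ℝ | x 0 ∈ Icc (0:ℝ) 1}
      (fun z : Fin 1 → ℝ => (z 0) ^ (q : ℝ) * (1 - z 0) ^ (b : ℝ) * (1 + z 0)⁻¹) := by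
    refine isSemialgebraicFunOn_Icc_of_Ioo ?_ 0 0 (fun x hx => ?_) (fun x hx => ?_)
    · have h1 := isSemialgebraicFunOn_aeval BallPeeling.isSemialgebraic_posIoo
        ((1 + MvPolynomial.X 0) : MvPolynomial (Fin 1) ℚ)
      refine (IsSemialgebraicFunOn.div (isSemialgebraicFunOn_const_mul_rpow_mul_rpow 1 q b) h1
        fun x hx => ?_).congr fun x _ => ?_
      · have hx' : 0 < x 0 ∧ x 0 < 1 := hx
        have : (1 + x 0) ≠ 0 := by linarith [hx'.1]
        simpa using this
      · simp only [Rat.cast_one, one_mul, map_add, map_one, MvPolynomial.aeval_X, div_eq_mul_inv]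
    · simp only [hx, Real.zero_rpow hq', zero_mul, Rat.cast_zero]
    · simp only [hx, sub_self, Real.zero_rpow hb', mul_zero, zero_mul, Rat.cast_zero]
  have hNL : of D - of Z ∈ newtonLeibnizRel := by
    refine ⟨0, D, Z, fun _ => ((0:ℕ):ℝ), fun _ => ((0:ℕ):ℝ) + 1,
      fun z => (z (Fin.last 0)) ^ (q : ℝ) * (1 - z (Fin.last 0)) ^ (b : ℝ) * (1 + z (Fin.last 0))⁻¹,
      by rw [hDd]; exact hF_sa,
      by rw [hZd]; exact isSemialgebraicFunOn_natCast isSemialgebraic_univ 0, ?_,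
      fun _ _ => by simp, ?_, ?_, ?_, ?_, rfl⟩
    · rw [hZd]
      exact (isSemialgebraicFunOn_aeval isSemialgebraic_univ
        (((0:ℕ) : MvPolynomial (Fin 0) ℚ) + 1)).congr fun x _ => by simp
    · rw [hDd, hZd]
      ext z
      simp only [mem_univ, true_and, mem_setOf_eq, mem_Icc, Nat.cast_zero, zero_add]
      rfl
    · intro x _
      simp only [Fin.snoc_last, Nat.cast_zero, zero_add]
      exact ((continuousOn_id.rpow_const fun t _ => Or.inr hqR.le).mul
        ((continuousOn_const.sub continuousOn_id).rpow_const fun t _ => Or.inr hbR.le)).mul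
        ((continuousOn_const.add continuousOn_id).inv₀ fun t ht => by
          show (1:ℝ) + t ≠ 0
          exact (add_pos_of_pos_of_nonneg one_pos (show (0:ℝ) ≤ t from ht.1)).ne')
    · intro x _ t ht
      simp only [Nat.cast_zero, zero_add] at ht
      simp only [Fin.snoc_last, hDi]
      rw [show (0 : Fin 1) = Fin.last 0 from rfl, Fin.snoc_last]
      have hgt' : g t = ((q : ℝ) * t ^ ((q : ℝ) - 1) * (1 - t) ^ (b : ℝ) +
          t ^ (q : ℝ) * (-1 * (b : ℝ) * (1 - t) ^ ((b : ℝ) - 1))) * (1 + t)⁻¹ +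
          t ^ (q : ℝ) * (1 - t) ^ (b : ℝ) * (-1 / (1 + t) ^ 2) := by simp only [hgdef, if_pos ht]
      rw [hgt']
      have hS : (1 + t) ≠ 0 := by linarith [ht.1]
      have hd := (hasDerivAt_rpow_mul_one_sub_rpow (a := (q:ℝ)) (b := (b:ℝ)) ht).mul
        (((hasDerivAt_id' t).const_add (1:ℝ)).inv hS)
      exact hd
    · intro x _
      simp only [hZi, Pi.zero_apply, Fin.snoc_last, Nat.cast_zero, zero_add, Real.one_rpow,
        sub_self, Real.zero_rpow hb', Real.zero_rpow hq', mul_zero, zero_mul, sub_zero]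
  have hZ_mem : of Z ∈ relations := of_mem_relations_of_eqOn_zero Z (by rw [hZi]; exact fun _ _ => rfl)
  have hD_mem : of D ∈ relations := by
    have := relations.add_mem (newtonLeibnizRel_subset_relations hNL) hZ_mem
    rwa [sub_add_cancel] at this
  -- its open restriction
  have hsub : {x : Fin 1 → ℝ | x 0 ∈ Ioo (0:ℝ) 1} ⊆ D.domain := by
    rw [hDd]
    exact fun x hx => ⟨hx.1.le, hx.2.le⟩
  set D₀ := D.restrict _ BallPeeling.isSemialgebraic_posIoo hsub with hD₀
  have hD₀_mem : of D₀ ∈ relations := by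
    have h1 := D.of_sub_of_restrict_mem_relations BallPeeling.isSemialgebraic_posIoo hsub
      (by rw [hDd]; exact volume_setOf_Icc_diff_Ioo)
    have := relations.sub_mem hD_mem h1
    rwa [sub_sub_cancel] at this
  -- integrand additivity on (0,1): S = D₀ + ρ'
  have hadd : of S - of D₀ - of ρ' ∈ integrandAddRel := by
    refine ⟨1, S, D₀, ρ', by rw [hSd]; rfl, by rw [hρ'd, hSd], fun x hx => ?_, rfl⟩
    have hx' : x 0 ∈ Ioo (0:ℝ) 1 := by rw [hSd] at hx; exact hx
    have hxρ' : x ∈ ρ'.domain := by rw [hρ'd]; exact hx'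
    rw [Pi.add_apply, hSi hx, hρ'i hxρ']
    simp only [hD₀, IntegralRep.integrand_restrict, hDi]
    rw [hgt _ hx']
    ring
  have := relations.add_mem (integrandAddRel_subset_relations hadd) hD₀_mem
  have h' : of S - of D₀ - of ρ' + of D₀ = of S - of ρ' := by abel
  rw [h'] at this
  exact this

/-! ### THEOREM XIII: `⟦[pt,4^q]⟧ · ⟦[pt,c]⟧ · ⟦β(q,b)⟧ = ⟦β(p,q)⟧` -/

/-- **The second-kind inversion move (rule 2).** For `q = 3/2 − p`, `b = 2p − 1`, a pinned
`S = [(0,1), t^{q−1}(1−t)^b/(1+t)²]` and a pinned `B = β(p, q)`: the substitution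
`u = ((1−t)/(1+t))²` gives `[4^q · S] − [B] ∈ changeOfVariablesRel`.
[Kontsevich–Zagier 2001, §1.2 rule (2); this work] -/
theorem soloInformed_inversion₂_mem_changeOfVariablesRel (p q b : ℚ) (hq : q = 3 / 2 - p)
    (hb : b = 2 * p - 1) (h4 : IsAlgebraic ℚ ((4:ℝ) ^ (q : ℝ))) (S B : IntegralRep 1)
    (hSd : S.domain = {t | t 0 ∈ Ioo (0:ℝ) 1})
    (hSi : EqOn S.integrand
      (fun t => (t 0) ^ ((q : ℝ) - 1) * (1 - t 0) ^ (b : ℝ) / (1 + t 0) ^ 2) S.domain)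
    (hBd : B.domain = {t | t 0 ∈ Ioo (0:ℝ) 1})
    (hBi : EqOn B.integrand
      (fun t => (t 0) ^ ((p : ℝ) - 1) * (1 - t 0) ^ ((q : ℝ) - 1)) B.domain) :
    of (S.constMul ((4:ℝ) ^ (q : ℝ)) h4) - of B ∈ changeOfVariablesRel := by
  refine soloInformed_lift_mem_changeOfVariablesRel _ B (g' := soloInformedQuotDeriv)
    (by rw [IntegralRep.domain_constMul, hSd]) hBd ?_
    (fun t ht => soloInformed_hasDerivAt_quotFun (show 1 + t ≠ 0 by linarith [ht.1]))
    soloInformed_quotFun_subst.1 soloInformed_quotFun_subst.2 fun x hx => ?_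
  · rw [IntegralRep.domain_constMul, hSd]
    exact soloInformed_isSemialgebraicMapOn_lift_quotFun (hSd ▸ S.isSemialgebraic_domain)
      fun x hx => (show 0 < x 0 ∧ x 0 < 1 from hx).1
  · have hx' : 0 < x 0 ∧ x 0 < 1 := by
      rw [IntegralRep.domain_constMul, hSd] at hx
      exact hx
    have hΦ : soloInformedLift soloInformedQuotFun x ∈ B.domain := by
      rw [hBd]
      exact soloInformed_quotFun_mem hx'.1 hx'.2
    have hxS : x ∈ S.domain := by rw [hSd]; exact hx'
    rw [IntegralRep.integrand_constMul]
    dsimp only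
    rw [hSi hxS, hBi hΦ]
    exact soloInformed_inversion₂_integrand_identity p q b hq hb hx'.1 hx'.2

/-- **THEOREM XIII (the second-kind inversion chain).** For every rational `p` with
`½ < p < 3/2`, `q = 3/2 − p`, `b = 2p − 1`, `c = p − ½`, and pinned `A = β(q, b)`, `B = β(p, q)`
on `(0,1)`:  `⟦[pt, 4^q]⟧ · (⟦[pt, c]⟧ · ⟦A⟧) = ⟦B⟧` in the formal period ring — one change of
variables, one additivity of integrands, one Newton–Leibniz move over the point (with the null
boundary); no cancellation, no `π`. Value: `4^q · c · B(q,b) = B(p,q)`. [this work] -/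
theorem soloInformed_secondKind_inversion_chain (p q b c : ℚ) (hq : q = 3 / 2 - p)
    (hb : b = 2 * p - 1) (hc : c = p - 1 / 2) (hp : 1 / 2 < p) (hp' : p < 3 / 2)
    (h4 : IsAlgebraic ℚ ((4:ℝ) ^ (q : ℝ))) (hca : IsAlgebraic ℚ ((c : ℝ)))
    (A B : IntegralRep 1)
    (hAd : A.domain = {t | t 0 ∈ Ioo (0:ℝ) 1})
    (hAi : EqOn A.integrand
      (fun t => (t 0) ^ ((q : ℝ) - 1) * (1 - t 0) ^ ((b : ℝ) - 1)) A.domain)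
    (hBd : B.domain = {t | t 0 ∈ Ioo (0:ℝ) 1})
    (hBi : EqOn B.integrand
      (fun t => (t 0) ^ ((p : ℝ) - 1) * (1 - t 0) ^ ((q : ℝ) - 1)) B.domain) :
    toFormalPeriod (of (IntegralRep.unit.constMul ((4:ℝ) ^ (q : ℝ)) h4)) *
      (toFormalPeriod (of (IntegralRep.unit.constMul ((c : ℝ)) hca)) * toFormalPeriod (of A)) =
      toFormalPeriod (of B) := by
  have hq0 : 0 < q := by rw [hq]; linarith
  have hb0 : 0 < b := by rw [hb]; linarith
  obtain ⟨S, hSd, hSi⟩ := soloInformed_exists_secondKindRep q b hq0 hb0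
  have hcov := soloInformed_inversion₂_mem_changeOfVariablesRel p q b hq hb h4 S B hSd
    (fun x _ => by rw [hSi]) hBd hBi
  have hred : Equivalent S (A.constMul ((c : ℝ)) hca) :=
    soloInformed_secondKind_reduction p q b c hq hb hc hp hp' S _ hSd (fun x _ => by rw [hSi])
      (by rw [IntegralRep.domain_constMul, hAd]) fun x hx => by
        have hxA : x ∈ A.domain := by rw [IntegralRep.domain_constMul] at hx; exact hx
        simp only [IntegralRep.integrand_constMul]
        rw [hAi hxA]
  rw [← toFormalPeriod_of_constMul, ← hred.toFormalPeriod_eq, ← toFormalPeriod_of_constMul]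
  exact toFormalPeriod_eq_iff.mpr (changeOfVariablesRel_subset_relations hcov)

end Summit.KontsevichZagierPeriods.KontsevichZagierPeriods.Theorems

end
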